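import Mathlib
import Summits.AtomisticToContinuum.Crystallization.Theorems.SquareWellLayerCakeGapTwelveToBarlowFiveFoldCounting

/-!
# Five-fold sparsity, the reduction (crux `SquareWellLayerCake.GapTwelveToBarlow`, card A)

Support for the stub `stub_fiveFoldSparsity` of line `Sketch` of crux stmt-AtomisticToContinuum-15807.
`fiveFoldSparsity_of_noHoles_of_subcubic`: NO HOLES + SUB-CUBIC FIVE-FOLD COUNT (two statements
about all-Good balls of one finite configuration, written out in the crux's own clauses) imply the
stub's conclusion — along any sequence of configurations with a.e. Good sites, for every `R > 0`
the fraction of sites within `R` of a five-fold bond tends to `0`.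
(`…FiveFoldStub.lean` restates this behind the registered stub signature verbatim.)
`card_fiveFoldNear_le` is the per-configuration count (nets + disjoint balls + the packing lemmas of
`…FiveFoldCounting.lean`).
-/

noncomputable section

open scoped BigOperators
open Filter Finset

namespace Summit.AtomisticToContinuum.Crystallization.Theorems.SquareWellLayerCakeGapTwelveToBarlow

open Literature.MathematicalPhysics.StatisticalMechanics

/-- **The deterministic count (one configuration).** If (i) every all-Good `D`-ball centred at a
site holds at least `c (D/2)³` sites within `D/2` (no holes) and (ii) every all-Good `2D`-ball
centred at a site holds at most `ε D³` five-fold sites within `D` (sub-cubic five-fold count),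
then the sites within `R` of a five-fold bond number at most
`#bad · (1 + (2(R+4D)/(55/57)+1)³) + (8ε/c) · (2R/(55/57)+1)³ · N`.
Proof: a site whose `(R+4D)`-ball is all-Good and which is within `R` of a five-fold site `j`
sees a DEEP `j` (all-Good `4D`-ball); deep five-fold sites are covered by the `D`-balls of a
`D`-separated net of them (each holding `≤ ε D³` of them), and the net points' disjoint `D/2`-balls
each hold `≥ c D³/8` sites, so the net has `≤ 8N/(c D³)` points; the remaining sites have a bad
site within `R + 4D` (`card_shallow_le`); non-bad sites within `R` of a given `j` pack. -/
theorem card_fiveFoldNear_le {N : ℕ} (x : Fin N → EuclideanSpace ℝ (Fin 3)) {R D c ε : ℝ} (hR : 0 ≤ R) (hD : 0 < D)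
    (hc : 0 < c) (hε : 0 ≤ ε)
    (hH1 : ∀ i : Fin N, (∀ j : Fin N, dist (x i) (x j) ≤ D → j ∉ (Finset.univ.filter fun i' : Fin _ => ¬ (
          (∀ j', dist (x i') (x j') ≤ 11 / 10 → ∀ k', k' ≠ j' →
              (55 : ℝ) / 57 ≤ dist (x j') (x k')) ∧
          (Finset.univ.filter fun j' => j' ≠ i' ∧ dist (x i') (x j') ≤ 1).card = 12 ∧
          (Finset.univ.filter fun j' => j' ≠ i' ∧ dist (x i') (x j') ≤ 11 / 10).card ≤ 12))) →
      c * (D / 2) ^ 3 ≤ (Finset.univ.filter fun j : Fin N => dist (x i) (x j) ≤ D / 2).card)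
    (hH2 : ∀ i : Fin N, (∀ j : Fin N, dist (x i) (x j) ≤ 2 * D → j ∉ (Finset.univ.filter fun i' : Fin _ => ¬ (
          (∀ j', dist (x i') (x j') ≤ 11 / 10 → ∀ k', k' ≠ j' →
              (55 : ℝ) / 57 ≤ dist (x j') (x k')) ∧
          (Finset.univ.filter fun j' => j' ≠ i' ∧ dist (x i') (x j') ≤ 1).card = 12 ∧
          (Finset.univ.filter fun j' => j' ≠ i' ∧ dist (x i') (x j') ≤ 11 / 10).card ≤ 12))) →
      ((Finset.univ.filter fun j : Fin N =>
        dist (x i) (x j) ≤ D ∧ j ∈ (Finset.univ.filter fun j' : Fin _ => ∃ k', j' ≠ k' ∧ dist (x j') (x k') ≤ 1 ∧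
              (Finset.univ.filter fun l' => l' ≠ j' ∧ l' ≠ k' ∧ dist (x j') (x l') ≤ 1 ∧
                dist (x k') (x l') ≤ 1).card = 5)).card : ℝ) ≤ ε * D ^ 3) :
    ((Finset.univ.filter fun i : Fin N =>
        ∃ j ∈ (Finset.univ.filter fun j' : Fin _ => ∃ k', j' ≠ k' ∧ dist (x j') (x k') ≤ 1 ∧
              (Finset.univ.filter fun l' => l' ≠ j' ∧ l' ≠ k' ∧ dist (x j') (x l') ≤ 1 ∧
                dist (x k') (x l') ≤ 1).card = 5), dist (x i) (x j) ≤ R).card : ℝ) ≤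
      ((Finset.univ.filter fun i' : Fin _ => ¬ (
            (∀ j', dist (x i') (x j') ≤ 11 / 10 → ∀ k', k' ≠ j' →
                (55 : ℝ) / 57 ≤ dist (x j') (x k')) ∧
            (Finset.univ.filter fun j' => j' ≠ i' ∧ dist (x i') (x j') ≤ 1).card = 12 ∧
            (Finset.univ.filter fun j' => j' ≠ i' ∧ dist (x i') (x j') ≤ 11 / 10).card ≤ 12))).card * (1 + (2 * (R + 4 * D) / (55 / 57) + 1) ^ 3) +
        8 * ε / c * (2 * R / (55 / 57) + 1) ^ 3 * N := by
  classical
  -- the sets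
  set T := Finset.univ.filter fun i : Fin N => ∃ j ∈ (Finset.univ.filter fun j' : Fin _ => ∃ k', j' ≠ k' ∧ dist (x j') (x k') ≤ 1 ∧
        (Finset.univ.filter fun l' => l' ≠ j' ∧ l' ≠ k' ∧ dist (x j') (x l') ≤ 1 ∧
          dist (x k') (x l') ≤ 1).card = 5), dist (x i) (x j) ≤ R with hT
  set Sh := Finset.univ.filter fun i : Fin N =>
    ∃ j : Fin N, dist (x i) (x j) ≤ R + 4 * D ∧ j ∈ (Finset.univ.filter fun i' : Fin _ => ¬ (
          (∀ j', dist (x i') (x j') ≤ 11 / 10 → ∀ k', k' ≠ j' →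
              (55 : ℝ) / 57 ≤ dist (x j') (x k')) ∧
          (Finset.univ.filter fun j' => j' ≠ i' ∧ dist (x i') (x j') ≤ 1).card = 12 ∧
          (Finset.univ.filter fun j' => j' ≠ i' ∧ dist (x i') (x j') ≤ 11 / 10).card ≤ 12)) with hSh
  set J := Finset.univ.filter fun j : Fin N =>
    j ∈ (Finset.univ.filter fun j' : Fin _ => ∃ k', j' ≠ k' ∧ dist (x j') (x k') ≤ 1 ∧
          (Finset.univ.filter fun l' => l' ≠ j' ∧ l' ≠ k' ∧ dist (x j') (x l') ≤ 1 ∧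
            dist (x k') (x l') ≤ 1).card = 5) ∧ ∀ l : Fin N, dist (x j) (x l) ≤ 4 * D → l ∉ (Finset.univ.filter fun i' : Fin _ => ¬ (
          (∀ j', dist (x i') (x j') ≤ 11 / 10 → ∀ k', k' ≠ j' →
              (55 : ℝ) / 57 ≤ dist (x j') (x k')) ∧
          (Finset.univ.filter fun j' => j' ≠ i' ∧ dist (x i') (x j') ≤ 1).card = 12 ∧
          (Finset.univ.filter fun j' => j' ≠ i' ∧ dist (x i') (x j') ≤ 11 / 10).card ≤ 12)) with hJ
  set KR : ℝ := (2 * R / (55 / 57) + 1) ^ 3 with hKR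
  have hKR0 : 0 ≤ KR := by positivity
  -- Claim 1: T ⊆ Sh ∪ ⋃_{j ∈ J} {non-bad i within R of j}
  have hsub : T ⊆ Sh ∪ J.biUnion
      (fun j => Finset.univ.filter fun i : Fin N => i ∉ (Finset.univ.filter fun i' : Fin _ => ¬ (
            (∀ j', dist (x i') (x j') ≤ 11 / 10 → ∀ k', k' ≠ j' →
                (55 : ℝ) / 57 ≤ dist (x j') (x k')) ∧
            (Finset.univ.filter fun j' => j' ≠ i' ∧ dist (x i') (x j') ≤ 1).card = 12 ∧
            (Finset.univ.filter fun j' => j' ≠ i' ∧ dist (x i') (x j') ≤ 11 / 10).card ≤ 12)) ∧ dist (x i) (x j) ≤ R) := by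
    intro i hi
    obtain ⟨j, hj, hij⟩ := (Finset.mem_filter.1 hi).2
    by_cases hsh : i ∈ Sh
    · exact Finset.mem_union_left _ hsh
    · apply Finset.mem_union_right
      have hdeep : ∀ l : Fin N, dist (x i) (x l) ≤ R + 4 * D → l ∉ (Finset.univ.filter fun i' : Fin _ => ¬ (
            (∀ j', dist (x i') (x j') ≤ 11 / 10 → ∀ k', k' ≠ j' →
                (55 : ℝ) / 57 ≤ dist (x j') (x k')) ∧
            (Finset.univ.filter fun j' => j' ≠ i' ∧ dist (x i') (x j') ≤ 1).card = 12 ∧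
            (Finset.univ.filter fun j' => j' ≠ i' ∧ dist (x i') (x j') ≤ 11 / 10).card ≤ 12)) := by
        intro l hl hlbad
        exact hsh (Finset.mem_filter.2 ⟨Finset.mem_univ _, l, hl, hlbad⟩)
      rw [Finset.mem_biUnion]
      refine ⟨j, Finset.mem_filter.2 ⟨Finset.mem_univ _, hj, ?_⟩, ?_⟩
      · intro l hl
        apply hdeep
        calc dist (x i) (x l) ≤ dist (x i) (x j) + dist (x j) (x l) := dist_triangle _ _ _
          _ ≤ R + 4 * D := by linarith
      · refine Finset.mem_filter.2 ⟨Finset.mem_univ _, ?_, hij⟩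
        apply hdeep
        rw [dist_self]; positivity
  have h1 : (T.card : ℝ) ≤ Sh.card + (J.biUnion
      (fun j => Finset.univ.filter fun i : Fin N => i ∉ (Finset.univ.filter fun i' : Fin _ => ¬ (
            (∀ j', dist (x i') (x j') ≤ 11 / 10 → ∀ k', k' ≠ j' →
                (55 : ℝ) / 57 ≤ dist (x j') (x k')) ∧
            (Finset.univ.filter fun j' => j' ≠ i' ∧ dist (x i') (x j') ≤ 1).card = 12 ∧
            (Finset.univ.filter fun j' => j' ≠ i' ∧ dist (x i') (x j') ≤ 11 / 10).card ≤ 12)) ∧ dist (x i) (x j) ≤ R)).card := by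
    exact_mod_cast (Finset.card_le_card hsub).trans (Finset.card_union_le _ _)
  -- Claim 2: the union over J has ≤ #J · KR elements
  have h2 : ((J.biUnion
      (fun j => Finset.univ.filter fun i : Fin N => i ∉ (Finset.univ.filter fun i' : Fin _ => ¬ (
            (∀ j', dist (x i') (x j') ≤ 11 / 10 → ∀ k', k' ≠ j' →
                (55 : ℝ) / 57 ≤ dist (x j') (x k')) ∧
            (Finset.univ.filter fun j' => j' ≠ i' ∧ dist (x i') (x j') ≤ 1).card = 12 ∧
            (Finset.univ.filter fun j' => j' ≠ i' ∧ dist (x i') (x j') ≤ 11 / 10).card ≤ 12)) ∧ dist (x i) (x j) ≤ R)).card : ℝ)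
        ≤ J.card * KR := by
    calc ((J.biUnion (fun j => Finset.univ.filter fun i : Fin N =>
            i ∉ (Finset.univ.filter fun i' : Fin _ => ¬ (
                  (∀ j', dist (x i') (x j') ≤ 11 / 10 → ∀ k', k' ≠ j' →
                      (55 : ℝ) / 57 ≤ dist (x j') (x k')) ∧
                  (Finset.univ.filter fun j' => j' ≠ i' ∧ dist (x i') (x j') ≤ 1).card = 12 ∧
                  (Finset.univ.filter fun j' => j' ≠ i' ∧ dist (x i') (x j') ≤ 11 / 10).card ≤ 12)) ∧ dist (x i) (x j) ≤ R)).card : ℝ)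
        ≤ ∑ j ∈ J, ((Finset.univ.filter fun i : Fin N =>
            i ∉ (Finset.univ.filter fun i' : Fin _ => ¬ (
                  (∀ j', dist (x i') (x j') ≤ 11 / 10 → ∀ k', k' ≠ j' →
                      (55 : ℝ) / 57 ≤ dist (x j') (x k')) ∧
                  (Finset.univ.filter fun j' => j' ≠ i' ∧ dist (x i') (x j') ≤ 1).card = 12 ∧
                  (Finset.univ.filter fun j' => j' ≠ i' ∧ dist (x i') (x j') ≤ 11 / 10).card ≤ 12)) ∧ dist (x i) (x j) ≤ R).card : ℝ) := by
          exact_mod_cast Finset.card_biUnion_le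
      _ ≤ ∑ _j ∈ J, KR := Finset.sum_le_sum fun j _ => card_good_near_le x (x j) hR
      _ = J.card * KR := by simp
  -- Claim 3: a D-net M of J
  obtain ⟨M, hMJ, hMsep, hMcov⟩ := exists_separated_net J x hD.le
  have hMdeep : ∀ m ∈ M, ∀ l : Fin N, dist (x m) (x l) ≤ 4 * D → l ∉ (Finset.univ.filter fun i' : Fin _ => ¬ (
        (∀ j', dist (x i') (x j') ≤ 11 / 10 → ∀ k', k' ≠ j' →
            (55 : ℝ) / 57 ≤ dist (x j') (x k')) ∧
        (Finset.univ.filter fun j' => j' ≠ i' ∧ dist (x i') (x j') ≤ 1).card = 12 ∧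
        (Finset.univ.filter fun j' => j' ≠ i' ∧ dist (x i') (x j') ≤ 11 / 10).card ≤ 12)) :=
    fun m hm => (Finset.mem_filter.1 (hMJ hm)).2.2
  -- Claim 4: #J ≤ #M · ε D³
  have h4 : (J.card : ℝ) ≤ M.card * (ε * D ^ 3) := by
    have hJsub : J ⊆ M.biUnion (fun m => Finset.univ.filter fun j : Fin N =>
        dist (x m) (x j) ≤ D ∧ j ∈ (Finset.univ.filter fun j' : Fin _ => ∃ k', j' ≠ k' ∧ dist (x j') (x k') ≤ 1 ∧
              (Finset.univ.filter fun l' => l' ≠ j' ∧ l' ≠ k' ∧ dist (x j') (x l') ≤ 1 ∧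
                dist (x k') (x l') ≤ 1).card = 5)) := by
      intro j hj
      obtain ⟨m, hm, hjm⟩ := hMcov j hj
      rw [Finset.mem_biUnion]
      refine ⟨m, hm, Finset.mem_filter.2 ⟨Finset.mem_univ _, ?_, (Finset.mem_filter.1 hj).2.1⟩⟩
      rwa [dist_comm]
    calc (J.card : ℝ) ≤ (M.biUnion (fun m => Finset.univ.filter fun j : Fin N =>
          dist (x m) (x j) ≤ D ∧ j ∈ (Finset.univ.filter fun j' : Fin _ => ∃ k', j' ≠ k' ∧ dist (x j') (x k') ≤ 1 ∧
                (Finset.univ.filter fun l' => l' ≠ j' ∧ l' ≠ k' ∧ dist (x j') (x l') ≤ 1 ∧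
                  dist (x k') (x l') ≤ 1).card = 5))).card := by
          exact_mod_cast Finset.card_le_card hJsub
      _ ≤ ∑ m ∈ M, ((Finset.univ.filter fun j : Fin N =>
          dist (x m) (x j) ≤ D ∧ j ∈ (Finset.univ.filter fun j' : Fin _ => ∃ k', j' ≠ k' ∧ dist (x j') (x k') ≤ 1 ∧
                (Finset.univ.filter fun l' => l' ≠ j' ∧ l' ≠ k' ∧ dist (x j') (x l') ≤ 1 ∧
                  dist (x k') (x l') ≤ 1).card = 5)).card : ℝ) := by
          exact_mod_cast Finset.card_biUnion_le
      _ ≤ ∑ _m ∈ M, ε * D ^ 3 := by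
          refine Finset.sum_le_sum fun m hm => hH2 m ?_
          intro l hl
          exact hMdeep m hm l (by linarith)
      _ = M.card * (ε * D ^ 3) := by simp
  -- Claim 5: #M · c (D/2)³ ≤ N (disjoint D/2-balls)
  have h5 : (M.card : ℝ) * (c * (D / 2) ^ 3) ≤ N := by
    set B := fun m : Fin N => Finset.univ.filter fun j : Fin N => dist (x m) (x j) ≤ D / 2 with hB
    have hdisj : (M : Set (Fin N)).PairwiseDisjoint B := by
      intro m hm m' hm' hne
      rw [Function.onFun, Finset.disjoint_left]
      intro j hj hj'
      have h1 := (Finset.mem_filter.1 hj).2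
      have h2 := (Finset.mem_filter.1 hj').2
      have := hMsep m hm m' hm' hne
      have := dist_triangle_right (x m) (x m') (x j)
      linarith
    have hcardU : (M.biUnion B).card = ∑ m ∈ M, (B m).card := Finset.card_biUnion hdisj
    have hle : (M.biUnion B).card ≤ N := by
      simpa using Finset.card_le_univ (M.biUnion B)
    calc (M.card : ℝ) * (c * (D / 2) ^ 3) = ∑ _m ∈ M, c * (D / 2) ^ 3 := by simp
      _ ≤ ∑ m ∈ M, ((B m).card : ℝ) := by
          refine Finset.sum_le_sum fun m hm => hH1 m ?_
          intro l hl
          exact hMdeep m hm l (by linarith)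
      _ = ((M.biUnion B).card : ℝ) := by rw [hcardU]; push_cast; rfl
      _ ≤ N := by exact_mod_cast hle
  -- Claim 6: assemble
  have hSh : (Sh.card : ℝ) ≤ ((Finset.univ.filter fun i' : Fin _ => ¬ (
        (∀ j', dist (x i') (x j') ≤ 11 / 10 → ∀ k', k' ≠ j' →
            (55 : ℝ) / 57 ≤ dist (x j') (x k')) ∧
        (Finset.univ.filter fun j' => j' ≠ i' ∧ dist (x i') (x j') ≤ 1).card = 12 ∧
        (Finset.univ.filter fun j' => j' ≠ i' ∧ dist (x i') (x j') ≤ 11 / 10).card ≤ 12))).card * (1 + (2 * (R + 4 * D) / (55 / 57) + 1) ^ 3) :=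
    card_shallow_le x (by positivity)
  have hD3 : 0 < D ^ 3 := by positivity
  have hM : (M.card : ℝ) ≤ 8 / (c * D ^ 3) * N := by
    rw [div_mul_eq_mul_div, le_div_iff₀ (by positivity)]
    nlinarith
  have hJ : (J.card : ℝ) ≤ 8 * ε / c * N := by
    calc (J.card : ℝ) ≤ M.card * (ε * D ^ 3) := h4
      _ ≤ 8 / (c * D ^ 3) * N * (ε * D ^ 3) := by gcongr
      _ = 8 * ε / c * N := by field_simp
  calc (T.card : ℝ) ≤ Sh.card + J.card * KR := by linarith
    _ ≤ ((Finset.univ.filter fun i' : Fin _ => ¬ (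
          (∀ j', dist (x i') (x j') ≤ 11 / 10 → ∀ k', k' ≠ j' →
              (55 : ℝ) / 57 ≤ dist (x j') (x k')) ∧
          (Finset.univ.filter fun j' => j' ≠ i' ∧ dist (x i') (x j') ≤ 1).card = 12 ∧
          (Finset.univ.filter fun j' => j' ≠ i' ∧ dist (x i') (x j') ≤ 11 / 10).card ≤ 12))).card * (1 + (2 * (R + 4 * D) / (55 / 57) + 1) ^ 3) + 8 * ε / c * N * KR := by
        gcongr
    _ = _ := by ring

/-- Non-membership in the bad set read as the Good clause. -/
theorem not_mem_bad_iff {N : ℕ} (x : Fin N → EuclideanSpace ℝ (Fin 3)) (i : Fin N) :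
    i ∉ (Finset.univ.filter fun i' : Fin _ => ¬ (
          (∀ j', dist (x i') (x j') ≤ 11 / 10 → ∀ k', k' ≠ j' →
              (55 : ℝ) / 57 ≤ dist (x j') (x k')) ∧
          (Finset.univ.filter fun j' => j' ≠ i' ∧ dist (x i') (x j') ≤ 1).card = 12 ∧
          (Finset.univ.filter fun j' => j' ≠ i' ∧ dist (x i') (x j') ≤ 11 / 10).card ≤ 12)) ↔
      ((∀ j : Fin N, dist (x i) (x j) ≤ 11 / 10 → ∀ k : Fin N, k ≠ j → (55 : ℝ) / 57 ≤ dist (x j) (x k)) ∧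
        (Finset.univ.filter fun j : Fin N => j ≠ i ∧ dist (x i) (x j) ≤ 1).card = 12 ∧
        (Finset.univ.filter fun j : Fin N => j ≠ i ∧ dist (x i) (x j) ≤ 11 / 10).card ≤ 12) := by
  classical
  simp only [Finset.mem_filter, Finset.mem_univ, true_and, not_not]

/-- **FIVE-FOLD SPARSITY FROM TWO GEOMETRIC INPUTS (the reduction).**  Hypotheses, both about
ALL-GOOD balls of a single finite configuration (no energy, no minimality, no limit):
* `hNoHoles` — NO HOLES: for some `c > 0` and all large `D`, a site whose `2D`-ball is all-Good has
  at least `c·D³` sites within distance `D` (all-Good regions have no voids: a Good site's twelve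
  neighbours cannot leave an empty cap; M/L);
* `hSubcubic` — SUB-CUBIC FIVE-FOLD COUNT: for every `ε > 0` there are arbitrarily large `D` such
  that a site whose `2D`-ball is all-Good has at most `ε·D³` five-fold sites within `D` (the
  output of the cone-deficit mechanism of idea card `cone-deficit-fivefold-sparsity`: link zoo at
  the window `[55/57, 1] ∪ (11/10, ∞)`, signed cone deficit, growth comparison; XL).
Conclusion: along ANY sequence of configurations with a.e. Good sites, for every `R > 0` the
fraction of sites within `R` of a five-fold bond tends to zero (`card_fiveFoldNear_le` + limits). -/
theorem fiveFoldSparsity_of_noHoles_of_subcubic :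
    (∃ c : ℝ, 0 < c ∧ ∃ D₀ : ℝ, ∀ (N : ℕ) (x : Fin N → EuclideanSpace ℝ (Fin 3))
      (i : Fin N) (D : ℝ), D₀ ≤ D →
      (∀ j : Fin N, dist (x i) (x j) ≤ 2 * D →
        ((∀ j' : Fin N, dist (x j) (x j') ≤ 11 / 10 → ∀ k : Fin N, k ≠ j' →
            (55 : ℝ) / 57 ≤ dist (x j') (x k)) ∧
          (Finset.univ.filter fun j' : Fin N => j' ≠ j ∧ dist (x j) (x j') ≤ 1).card = 12 ∧
          (Finset.univ.filter fun j' : Fin N => j' ≠ j ∧ dist (x j) (x j') ≤ 11 / 10).card ≤ 12)) →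
      c * D ^ 3 ≤ (Finset.univ.filter fun j : Fin N => dist (x i) (x j) ≤ D).card) →
    (∀ ε : ℝ, 0 < ε → ∀ D₁ : ℝ, ∃ D : ℝ, D₁ ≤ D ∧
      ∀ (N : ℕ) (x : Fin N → EuclideanSpace ℝ (Fin 3)) (i : Fin N),
      (∀ j : Fin N, dist (x i) (x j) ≤ 2 * D →
        ((∀ j' : Fin N, dist (x j) (x j') ≤ 11 / 10 → ∀ k : Fin N, k ≠ j' →
            (55 : ℝ) / 57 ≤ dist (x j') (x k)) ∧
          (Finset.univ.filter fun j' : Fin N => j' ≠ j ∧ dist (x j) (x j') ≤ 1).card = 12 ∧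
          (Finset.univ.filter fun j' : Fin N => j' ≠ j ∧ dist (x j) (x j') ≤ 11 / 10).card ≤ 12)) →
      ((Finset.univ.filter fun j : Fin N => dist (x i) (x j) ≤ D ∧
          ∃ k : Fin N, j ≠ k ∧ dist (x j) (x k) ≤ 1 ∧
            (Finset.univ.filter fun l : Fin N =>
              l ≠ j ∧ l ≠ k ∧ dist (x j) (x l) ≤ 1 ∧ dist (x k) (x l) ≤ 1).card = 5).card : ℝ) ≤
        ε * D ^ 3) →
    ∀ x : (N : ℕ) → (Fin N → EuclideanSpace ℝ (Fin 3)),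
      Filter.Tendsto (fun N : ℕ => (Nat.card {i : Fin N // ¬ (
          (∀ j : Fin N, dist (x N i) (x N j) ≤ 11 / 10 → ∀ k : Fin N, k ≠ j →
              (55 : ℝ) / 57 ≤ dist (x N j) (x N k)) ∧
          (Finset.univ.filter fun j : Fin N => j ≠ i ∧ dist (x N i) (x N j) ≤ 1).card = 12 ∧
          (Finset.univ.filter fun j : Fin N => j ≠ i ∧ dist (x N i) (x N j) ≤ 11 / 10).card ≤ 12)} : ℝ) / N)
        Filter.atTop (nhds 0) →
      ∀ R : ℝ, 0 < R →
        Filter.Tendsto (fun N : ℕ => (Nat.card {i : Fin N // ∃ j k : Fin N,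
          (j ≠ k ∧ dist (x N j) (x N k) ≤ 1 ∧
            (Finset.univ.filter fun l : Fin N =>
              l ≠ j ∧ l ≠ k ∧ dist (x N j) (x N l) ≤ 1 ∧ dist (x N k) (x N l) ≤ 1).card = 5) ∧
          dist (x N i) (x N j) ≤ R} : ℝ) / N)
          Filter.atTop (nhds 0) := by
  classical
  intro hNoHoles hSubcubic x hbad R hR
  obtain ⟨c, hc, D₀, hH1⟩ := hNoHoles
  rw [Metric.tendsto_nhds] at hbad ⊢
  intro η hη
  set KR : ℝ := (2 * R / (55 / 57) + 1) ^ 3 with hKR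
  have hKRpos : 0 < KR := by positivity
  set ε : ℝ := η * c / (32 * KR) with hε
  have hε0 : 0 < ε := by positivity
  obtain ⟨D, hD1, hH2⟩ := hSubcubic ε hε0 (max (2 * D₀) 1)
  have hDone : 1 ≤ D := le_trans (le_max_right _ _) hD1
  have hDpos : 0 < D := by linarith
  have hD₀ : D₀ ≤ D / 2 := by
    have := le_trans (le_max_left _ _) hD1
    linarith
  set K' : ℝ := 1 + (2 * (R + 4 * D) / (55 / 57) + 1) ^ 3 with hK'
  have hK'pos : 0 < K' := by positivity
  have hev1 := hbad (η / (2 * K')) (by positivity)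
  have hev2 : ∀ᶠ N : ℕ in Filter.atTop, 1 ≤ N := Filter.eventually_ge_atTop 1
  filter_upwards [hev1, hev2] with N hN hN1
  have hNpos : (0 : ℝ) < N := by exact_mod_cast hN1
  -- identify the two `Nat.card`s with `Finset.card`s
  have hbadcard : (Nat.card {i : Fin N // ¬ (
      (∀ j : Fin N, dist (x N i) (x N j) ≤ 11 / 10 → ∀ k : Fin N, k ≠ j →
          (55 : ℝ) / 57 ≤ dist (x N j) (x N k)) ∧
      (Finset.univ.filter fun j : Fin N => j ≠ i ∧ dist (x N i) (x N j) ≤ 1).card = 12 ∧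
      (Finset.univ.filter fun j : Fin N => j ≠ i ∧ dist (x N i) (x N j) ≤ 11 / 10).card ≤ 12)} : ℝ)
        = ((Finset.univ.filter fun i' : Fin _ => ¬ (
              (∀ j', dist ((x N) i') ((x N) j') ≤ 11 / 10 → ∀ k', k' ≠ j' →
                  (55 : ℝ) / 57 ≤ dist ((x N) j') ((x N) k')) ∧
              (Finset.univ.filter fun j' => j' ≠ i' ∧ dist ((x N) i') ((x N) j') ≤ 1).card = 12 ∧
              (Finset.univ.filter fun j' => j' ≠ i' ∧ dist ((x N) i') ((x N) j') ≤ 11 / 10).card ≤ 12))).card := by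
    rw [Nat.subtype_card ((Finset.univ.filter fun i' : Fin _ => ¬ (
          (∀ j', dist ((x N) i') ((x N) j') ≤ 11 / 10 → ∀ k', k' ≠ j' →
              (55 : ℝ) / 57 ≤ dist ((x N) j') ((x N) k')) ∧
          (Finset.univ.filter fun j' => j' ≠ i' ∧ dist ((x N) i') ((x N) j') ≤ 1).card = 12 ∧
          (Finset.univ.filter fun j' => j' ≠ i' ∧ dist ((x N) i') ((x N) j') ≤ 11 / 10).card ≤ 12)))]
    intro i
    simp only [Finset.mem_filter, Finset.mem_univ, true_and]
  have hTcard : (Nat.card {i : Fin N // ∃ j k : Fin N,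
      (j ≠ k ∧ dist (x N j) (x N k) ≤ 1 ∧
        (Finset.univ.filter fun l : Fin N =>
          l ≠ j ∧ l ≠ k ∧ dist (x N j) (x N l) ≤ 1 ∧ dist (x N k) (x N l) ≤ 1).card = 5) ∧
      dist (x N i) (x N j) ≤ R} : ℝ)
        = (Finset.univ.filter fun i : Fin N =>
            ∃ j ∈ (Finset.univ.filter fun j' : Fin _ => ∃ k', j' ≠ k' ∧ dist ((x N) j') ((x N) k') ≤ 1 ∧
                  (Finset.univ.filter fun l' => l' ≠ j' ∧ l' ≠ k' ∧ dist ((x N) j') ((x N) l') ≤ 1 ∧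
                    dist ((x N) k') ((x N) l') ≤ 1).card = 5), dist (x N i) (x N j) ≤ R).card := by
    rw [Nat.subtype_card (Finset.univ.filter fun i : Fin N =>
      ∃ j ∈ (Finset.univ.filter fun j' : Fin _ => ∃ k', j' ≠ k' ∧ dist ((x N) j') ((x N) k') ≤ 1 ∧
            (Finset.univ.filter fun l' => l' ≠ j' ∧ l' ≠ k' ∧ dist ((x N) j') ((x N) l') ≤ 1 ∧
              dist ((x N) k') ((x N) l') ≤ 1).card = 5), dist (x N i) (x N j) ≤ R)]
    intro i
    simp only [Finset.mem_filter, Finset.mem_univ, true_and]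
    constructor
    · rintro ⟨j, ⟨k, hk⟩, hj⟩
      exact ⟨j, k, hk, hj⟩
    · rintro ⟨j, k, hk, hj⟩
      exact ⟨j, ⟨k, hk⟩, hj⟩
  -- the deterministic count at this `N`
  have hcount := card_fiveFoldNear_le (x N) hR.le hDpos hc hε0.le
    (fun i hi => by
      have := hH1 N (x N) i (D / 2) hD₀ (fun j hj =>
        (not_mem_bad_iff (x N) j).1 (hi j (by linarith)))
      simpa using this)
    (fun i hi => by
      have key := hH2 N (x N) i (fun j hj => (not_mem_bad_iff (x N) j).1 (hi j hj))
      have hset : (Finset.univ.filter fun j : Fin N => dist (x N i) (x N j) ≤ D ∧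
            ∃ k : Fin N, j ≠ k ∧ dist (x N j) (x N k) ≤ 1 ∧
              (Finset.univ.filter fun l : Fin N =>
                l ≠ j ∧ l ≠ k ∧ dist (x N j) (x N l) ≤ 1 ∧ dist (x N k) (x N l) ≤ 1).card = 5) =
          (Finset.univ.filter fun j : Fin N =>
            dist (x N i) (x N j) ≤ D ∧ j ∈ (Finset.univ.filter fun j' : Fin _ => ∃ k', j' ≠ k' ∧ dist ((x N) j') ((x N) k') ≤ 1 ∧
                  (Finset.univ.filter fun l' => l' ≠ j' ∧ l' ≠ k' ∧ dist ((x N) j') ((x N) l') ≤ 1 ∧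
                    dist ((x N) k') ((x N) l') ≤ 1).card = 5)) := by
        ext j
        simp only [Finset.mem_filter, Finset.mem_univ, true_and]
      rw [hset] at key
      exact key)
  -- arithmetic
  rw [Real.dist_0_eq_abs] at hN ⊢
  rw [hbadcard] at hN
  rw [hTcard]
  set T : ℝ := ((Finset.univ.filter fun i : Fin N =>
    ∃ j ∈ (Finset.univ.filter fun j' : Fin _ => ∃ k', j' ≠ k' ∧ dist ((x N) j') ((x N) k') ≤ 1 ∧
          (Finset.univ.filter fun l' => l' ≠ j' ∧ l' ≠ k' ∧ dist ((x N) j') ((x N) l') ≤ 1 ∧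
            dist ((x N) k') ((x N) l') ≤ 1).card = 5), dist (x N i) (x N j) ≤ R).card : ℝ) with hT
  set B : ℝ := (((Finset.univ.filter fun i' : Fin _ => ¬ (
        (∀ j', dist ((x N) i') ((x N) j') ≤ 11 / 10 → ∀ k', k' ≠ j' →
            (55 : ℝ) / 57 ≤ dist ((x N) j') ((x N) k')) ∧
        (Finset.univ.filter fun j' => j' ≠ i' ∧ dist ((x N) i') ((x N) j') ≤ 1).card = 12 ∧
        (Finset.univ.filter fun j' => j' ≠ i' ∧ dist ((x N) i') ((x N) j') ≤ 11 / 10).card ≤ 12))).card : ℝ) with hB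
  have hT0 : 0 ≤ T := by positivity
  have hB0 : 0 ≤ B := by positivity
  rw [abs_of_nonneg (by positivity)] at hN
  rw [abs_of_nonneg (by positivity), div_lt_iff₀ hNpos]
  have hBN : B < η / (2 * K') * N := (div_lt_iff₀ hNpos).1 hN
  have hεc : 8 * ε / c * KR = η / 4 := by
    rw [hε]
    field_simp
    ring
  calc T ≤ B * K' + 8 * ε / c * KR * N := hcount
    _ = B * K' + η / 4 * N := by rw [hεc]
    _ < η / (2 * K') * N * K' + η / 4 * N := by gcongr
    _ = (3 / 4 * η) * N := by field_simp; ring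
    _ < η * N := by nlinarith

end Summit.AtomisticToContinuum.Crystallization.Theorems.SquareWellLayerCakeGapTwelveToBarlow

end
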